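import Literature.Probability.LatticeModels.KCSignCondition
import Literature.Probability.LatticeModels.PlanarIsingDomainSpinorUniqueness
import Literature.Probability.RandomPlanarGeometry.CaratheodoryHalfPlane
import Literature.Probability.RandomPlanarGeometry.ConformalMapCaratheodoryProofs
import HarnessLib

/-!
# The sign condition in conformal coordinates (hypothesis (2) of the spinor boundary value problem)

Topic `Literature/Probability/LatticeModels`. The sign condition `JordanDomain.false_of_neg_near_frontier`
(`KCSignCondition.lean`) transported to the half-plane coordinate of a conformal bijection
`φ : Ω → ℍ` of a Jordan domain: for every `x₀ ∈ ℝ = ∂ℍ` and `r > 0` some `z ∈ Ω` with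
`|φ z - x₀| < r` has `hlim z ≥ 0` — exactly the shape of hypothesis (2) of
`eqOn_domainSpinorSq_of_bvp` (with `h = -hlim`). The transport uses Carathéodory's theorem for
Jordan domains (`JordanDomain.exists_continuousOn_extension_holds`) through the Cayley transform.

All proved; no named fact.

## References

* D. Chelkak, S. Smirnov, Invent. Math. 189 (2012), Remark 6.3. [ChelkakSmirnov2012Ising]
* D. Chelkak, C. Hongler, K. Izyurov, Ann. Math. 181 (2015), Prop. 3.9 (2), Remark 2.9. [ChelkakHonglerIzyurovAnnals2015]
* Ch. Pommerenke, Boundary Behaviour of Conformal Maps (1992), Thm. 2.6. [PommerenkeBBCM1992]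
-/

noncomputable section

open Set Metric Filter Topology Complex

namespace Literature.Probability.LatticeModels

open Site Literature.Probability.RandomPlanarGeometry
open UpperHalfPlane (upperHalfPlaneSet)

/-! ### The conformal equivalence `ℍ → Ω` of a conformal bijection `Ω → ℍ` -/

/-- The inverse of a conformal bijection `φ : Ω → ℍ` of an open set, bundled as a conformal
equivalence `ℍ → Ω`. [folklore] -/
def conformalEquivOfBijection {Ω : Set ℂ} {φ : ℂ → ℂ} (hΩ : IsOpen Ω) (hφ : IsConformalBijection φ Ω upperHalfPlaneSet) :
    ConformalEquiv upperHalfPlaneSet Ω where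
  toFun := Function.invFunOn φ Ω
  invFun := φ
  source := upperHalfPlaneSet
  target := Ω
  map_source' w hw := (invFunOn_conformal hΩ hφ).1.mapsTo hw
  map_target' z hz := hφ.2.mapsTo hz
  left_inv' w hw := (invFunOn_conformal hΩ hφ).2.2.1 w hw
  right_inv' z hz := (invFunOn_conformal hΩ hφ).2.1 z hz
  source_eq := rfl
  target_eq := rfl
  differentiableOn := by
    intro w hw
    obtain ⟨hbij, -, hφψ, -, hder⟩ := invFunOn_conformal hΩ hφ
    have := hder (Function.invFunOn φ Ω w) (hbij.mapsTo hw)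
    rw [hφψ w hw] at this
    exact this.differentiableAt.differentiableWithinAt
  differentiableOn_symm := hφ.1

/-- The bundled inverse acts as `invFunOn φ Ω`, its inverse as `φ`. [folklore] -/
theorem conformalEquivOfBijection_apply {Ω : Set ℂ} {φ : ℂ → ℂ} (hΩ : IsOpen Ω) (hφ : IsConformalBijection φ Ω upperHalfPlaneSet) (w : ℂ) :
    conformalEquivOfBijection hΩ hφ w = Function.invFunOn φ Ω w := rfl

/-! ### Inverse continuity of an injective continuous map of the closed disc -/

/-- An injective continuous map of the closed unit disc is open onto its image at every point:
points with image near `Ψ w₀` are near `w₀`. [folklore] -/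
theorem exists_near_of_image_near {Ψ : ℂ → ℂ} (hΨc : ContinuousOn Ψ (closedBall (0 : ℂ) 1)) (hΨi : InjOn Ψ (closedBall (0 : ℂ) 1))
    {w₀ : ℂ} (hw₀ : w₀ ∈ closedBall (0 : ℂ) 1) {ε : ℝ} (hε : 0 < ε) :
    ∃ ρ > 0, ∀ w ∈ closedBall (0 : ℂ) 1, dist (Ψ w) (Ψ w₀) < ρ → dist w w₀ < ε := by
  set K : Set ℂ := closedBall (0 : ℂ) 1 ∩ (ball w₀ ε)ᶜ with hK
  have hKc : IsCompact K := (isCompact_closedBall _ _).inter_right isOpen_ball.isClosed_compl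
  have hKi : IsCompact (Ψ '' K) := hKc.image_of_continuousOn (hΨc.mono inter_subset_left)
  have hnot : Ψ w₀ ∉ Ψ '' K := by
    rintro ⟨w, ⟨hw1, hw2⟩, hweq⟩
    have : w = w₀ := hΨi hw1 hw₀ hweq
    exact hw2 (this ▸ mem_ball_self hε)
  obtain ⟨ρ, hρ, hρsub⟩ := Metric.mem_nhds_iff.1 (hKi.isClosed.isOpen_compl.mem_nhds hnot)
  refine ⟨ρ, hρ, fun w hw hd => ?_⟩
  by_contra h
  exact hρsub (mem_ball.2 hd) ⟨w, ⟨hw, fun h' => h (mem_ball.1 h')⟩, rfl⟩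

/-! ### Neighbourhoods of boundary points in conformal coordinates -/

/-- **Real boundary points of `ℍ` correspond to boundary points of the Jordan domain**: for a
conformal bijection `φ : Ω → ℍ` of a Jordan domain, every `x₀ ∈ ℝ` and `r > 0` admit a boundary
point `p ∈ ∂Ω` and `ρ > 0` with `|φ z - x₀| < r` for all `z ∈ Ω ∩ ball p ρ`.
[cite: PommerenkeBBCM1992, Thm. 2.6 (Carathéodory)] -/
theorem exists_frontier_nhds_of_conformal (D : JordanDomain) {φ : ℂ → ℂ} (hφ : IsConformalBijection φ D.carrier upperHalfPlaneSet)
    (x₀ : ℝ) {r : ℝ} (hr : 0 < r) :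
    ∃ p ∈ frontier D.carrier, ∃ ρ > 0, ∀ z ∈ D.carrier, dist z p < ρ → dist (φ z) x₀ < r := by
  set ψe := conformalEquivOfBijection D.isOpen hφ with hψe
  set ψD : ConformalEquiv (ball (0 : ℂ) 1) D.carrier := cayley.symm.trans ψe with hψD
  obtain ⟨Ψ, hΨc, hΨeq, hΨbij, hΨbij'⟩ := JordanDomain.exists_continuousOn_extension_holds D ψD
  set w₀ : ℂ := cayleyFun x₀ with hw₀
  have hw₀s : w₀ ∈ Metric.sphere (0 : ℂ) 1 := by rw [mem_sphere_zero_iff_norm]; exact norm_cayleyFun_ofReal x₀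
  have hw₀c : w₀ ∈ closedBall (0 : ℂ) 1 := sphere_subset_closedBall hw₀s
  have hxI : (x₀ : ℂ) + Complex.I ≠ 0 := add_I_ne_zero (by simp)
  have hw₀1 : w₀ ≠ 1 := by
    intro h
    rw [hw₀, cayleyFun_apply, div_eq_one_iff_eq hxI] at h
    have := congrArg Complex.im h
    simp at this
    norm_num at this
  have hinv : cayleyInvFun w₀ = x₀ := by rw [hw₀, cayleyInvFun_cayleyFun hxI]
  -- continuity of the inverse Cayley map at `w₀`
  have hcont : ContinuousAt cayleyInvFun w₀ :=
    differentiableOn_cayleyInvFun.continuousOn.continuousAt (isOpen_ne.mem_nhds hw₀1)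
  obtain ⟨ε, hε, hεr⟩ := Metric.continuousAt_iff.1 hcont r hr
  -- inverse continuity of `Ψ` at `w₀`
  obtain ⟨ρ, hρ, hρε⟩ := exists_near_of_image_near hΨc hΨbij.injOn hw₀c hε
  refine ⟨Ψ w₀, hΨbij'.mapsTo hw₀s, ρ, hρ, fun z hz hzp => ?_⟩
  -- the disc coordinate of `z`
  have hφz : φ z ∈ upperHalfPlaneSet := hφ.2.mapsTo hz
  have hφzI : φ z + Complex.I ≠ 0 := add_I_ne_zero (le_of_lt hφz)
  set w : ℂ := cayleyFun (φ z) with hw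
  have hwb : w ∈ ball (0 : ℂ) 1 := cayley.mapsTo hφz
  have hΨw : Ψ w = z := by
    rw [hΨeq hwb, hψD, ConformalEquiv.trans_apply, cayley_symm_apply, hw, cayleyInvFun_cayleyFun hφzI, hψe,
      conformalEquivOfBijection_apply]
    exact (invFunOn_conformal D.isOpen hφ).2.1 z hz
  have h1 : dist w w₀ < ε := hρε w (ball_subset_closedBall hwb) (by rw [hΨw]; exact hzp)
  have h2 := hεr h1
  rw [hinv, hw, cayleyInvFun_cayleyFun hφzI] at h2
  exact h2

/-! ### The sign condition in the half-plane coordinate -/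

/-- **The sign condition of Kadanoff–Ceva limits in conformal coordinates** (hypothesis (2) of the
spinor boundary value problem, `h = -hlim`): for a Jordan domain `Ω` with conformal bijection
`φ : Ω → ℍ`, lattice functions `u_n` as in `JordanDomain.false_of_neg_near_frontier` with local
uniform limit `hlim` continuous on `Ω`, every `x₀ ∈ ℝ` and `r > 0` admit `z ∈ Ω` with
`|φ z - x₀| < r` and `hlim z ≥ 0`. [cite: ChelkakSmirnov2012Ising, Remark 6.3; ChelkakHonglerIzyurovAnnals2015, Prop. 3.9 (2)] -/
theorem JordanDomain.sign_condition_h2 (D : JordanDomain) {φ : ℂ → ℂ} (hφ : IsConformalBijection φ D.carrier upperHalfPlaneSet)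
    {G : Set ℂ} (hG : ∀ p ∈ frontier D.carrier, ∃ ρ > 0, ball p ρ ⊆ G)
    {a b : ℂ} {r : ℝ} (hr : 0 < r) (ha : closedBall a r ⊆ D.carrier) (hb : closedBall b r ⊆ D.carrier)
    {hlim : ℂ → ℝ} (hcont : ContinuousOn hlim D.carrier)
    (δ : ℕ → ℝ) (hδ : ∀ n, 0 < δ n) (hδ0 : Tendsto δ atTop (𝓝 0))
    (Λ : ℕ → Finset (Site 2)) (hΛ : ∀ n, HoleFree (↑(Λ n) : Set (Site 2)))
    (u : ℕ → Site 2 → ℝ) (N : ℕ → ℝ) (hN : ∀ n, 0 < N n) {Mu : ℝ} (hMu : 0 ≤ Mu)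
    (hSub : ∀ n, ∀ f : Site 2, (∃ i : Fin 4, f + cornerOff i ∈ Λ n) → ((δ n : ℝ) : ℂ) * plaqCentre f ∉ ball a r ∪ ball b r →
      0 ≤ kcModLaplacian (Λ n) (fun _ => 0) (u n) f)
    (hU0 : ∀ n, ∀ f : Site 2, (∃ i : Fin 4, f + cornerOff i ∉ Λ n) → ((δ n : ℝ) : ℂ) * plaqCentre f ∈ G → 0 ≤ u n f)
    (hUbd : ∀ n, ∀ f : Site 2, ((δ n : ℝ) : ℂ) * plaqCentre f ∈ G → u n f ≤ Mu * N n)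
    (hconv : ∀ K : Set ℂ, IsCompact K → K ⊆ D.carrier → ∀ ε, 0 < ε → ∀ᶠ n in atTop, ∀ f : Site 2,
      ((δ n : ℝ) : ℂ) * plaqCentre f ∈ K → |u n f / N n - hlim (((δ n : ℝ) : ℂ) * plaqCentre f)| ≤ ε)
    (hbulk : ∀ K : Set ℂ, IsCompact K → K ⊆ D.carrier → ∀ᶠ n in atTop, ∀ v : Site 2, ((δ n : ℝ) : ℂ) * toComplex v ∈ K → v ∈ Λ n)
    (hvis : ∀ ε : ℝ, 0 < ε → ∀ᶠ n in atTop, ∀ p ∈ frontier D.carrier, ∃ b : Site 2, b ∉ Λ n ∧ dist (((δ n : ℝ) : ℂ) * toComplex b) p ≤ ε)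
    (x₀ : ℝ) {r' : ℝ} (hr' : 0 < r') :
    ∃ z ∈ D.carrier, dist (φ z) x₀ < r' ∧ 0 ≤ hlim z := by
  obtain ⟨p, hp, ρ₁, hρ₁, hnear⟩ := exists_frontier_nhds_of_conformal D hφ x₀ hr'
  obtain ⟨ρG, hρG, hGsub⟩ := hG p hp
  set ρ₀ : ℝ := min ρ₁ ρG with hρ₀
  have hρ₀pos : 0 < ρ₀ := lt_min hρ₁ hρG
  by_contra h
  push Not at h
  have hneg : ∀ z ∈ D.carrier ∩ ball p ρ₀, hlim z < 0 := fun z hz =>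
    h z hz.1 (hnear z hz.1 (lt_of_lt_of_le (mem_ball.1 hz.2) (min_le_left _ _)))
  exact JordanDomain.false_of_neg_near_frontier D hp hρ₀pos ((ball_subset_ball (min_le_right _ _)).trans hGsub) hr ha hb
    (hcont.mono inter_subset_left) hneg δ hδ hδ0 Λ hΛ u N hN hMu hSub hU0 hUbd
    (fun K hK hKs => hconv K hK (hKs.trans inter_subset_left)) hbulk hvis

end Literature.Probability.LatticeModels
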